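import Literature.NumberTheory.Sieve.IwaniecBilinearSieveBoxes
import Literature.NumberTheory.Sieve.IwaniecBilinearSieveMainTerms
import HarnessLib

/-!
# Iwaniec's bilinear linear sieve, IV: the bilinear form of the remainder

Topic `Literature/NumberTheory/Sieve`; fourth support file for the proof of
`Literature.NumberTheory.Sieve.Iwaniec1978.lemma2_bilinearSieve` (H. Iwaniec, *A new form of the error
term in the linear sieve*, Acta Arith. 37 (1980), 307–320, Theorem 1 [IwaniecActaArith1980b]).  Here the
remainder `∑_{d ∣ P(z)} Λ(d) r(𝒜, d)` of the composite sieve "small primes `< u` (weights `φ^±`) ⊗ box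
weights on `[u, z)`" is written as a sum, over the patterns `k` of the finite universe, of BILINEAR FORMS
`∑_{m < M} ∑_{n < N, mn ∣ P(z)} a_k(m) b_k(n) r(𝒜, mn)` with coefficients bounded by `1` and independent of
`𝒜`, `z` and the density ("the remainder term has a bilinear form as desired", p. 312 and p. 316):

* for a pattern `k` split as `k = k_M + k_N` (Lemma 1, `Iwaniec1980b.splitK`), the coefficients are
  `a_k(m) = λ_k φ_k((m, P(u))) [pat(m/(m, P(u))) = k_M] / c_k`, `b_k(n) = [(n, P(u)) = 1][pat n = k_N]`,
  where `λ_k = (−1)^{|k|} [k admissible]`, `φ_k` is the inner weight selected by the sign of `λ_k`, and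
  `c_k = ∏_j C(k(j), k_M(j))` counts the ways of choosing, in each box, which of the primes of `t` go to `m`
  (`Iwaniec1980b.aCoef`, `bCoef`, `binomK`);
* the divisor count behind `c_k` (`card_divisors_pat_eq`): a squarefree `t` has exactly
  `∏_j C(#{p ∣ t in box j}, k_M(j))` divisors of pattern `k_M`;
* the pointwise identity `∑_{mn = d} a_k(m) b_k(n) = λ_k φ_k(e) [pat t = k]` for `d = e t`, `e ∣ P(u)`,
  `t ∣ P(z, u)` (`sum_aCoef_bCoef_eq`), the re-indexing of `∑_{m < M} ∑_{n < N} [mn ∣ P]` as a sum over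
  `d ∣ P` (`sum_Ico_Ico_eq_sum_divisors`), and the support bounds `a_k(m) ≠ 0 ⇒ m < level(φ) · (∏_{k_M} D_j)^{1+η}`,
  `b_k(n) ≠ 0 ⇒ n < (∏_{k_N} D_j)^{1+η}` (`lt_of_aCoef_ne_zero`, `lt_of_bCoef_ne_zero`).

Everything is PROVED; no facts.

## References

* H. Iwaniec, *A new form of the error term in the linear sieve*, Acta Arith. 37 (1980), 307–320: (9) p. 309,
  Lemma 1 and the end of §2 p. 312, (23)–(24) p. 316. [IwaniecActaArith1980b]
-/

open Finset Real
open scoped ArithmeticFunction.Moebius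

noncomputable section

namespace Literature.NumberTheory.Sieve

namespace Iwaniec1980b

/-! ### Counting the divisors of a given pattern -/

/-- `c(k, k_M) = ∏_{j ∈ B} C(k(j), k_M(j))`: the number of ways of choosing, in each box `j ∈ B`, `k_M(j)`
of the `k(j)` primes (`B` any finite set of boxes containing the supports). [folklore] -/
def binomK (B : Finset ℕ) (k kM : Multiset ℕ) : ℕ := ∏ j ∈ B, (k.count j).choose (kM.count j)

/-- Enlarging `B` beyond the supports does not change `binomK` (the extra factors are `C(0, 0) = 1`).
[folklore] -/
theorem binomK_eq_of_subset {B B' : Finset ℕ} {k kM : Multiset ℕ} (hB : k.toFinset ∪ kM.toFinset ⊆ B)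
    (hBB' : B ⊆ B') : binomK B' k kM = binomK B k kM := by
  unfold binomK
  refine (Finset.prod_subset hBB' fun j _ hjB => ?_).symm
  have hk : k.count j = 0 := Multiset.count_eq_zero.mpr fun h =>
    hjB (hB (Finset.mem_union_left _ (Multiset.mem_toFinset.mpr h)))
  have hkM : kM.count j = 0 := Multiset.count_eq_zero.mpr fun h =>
    hjB (hB (Finset.mem_union_right _ (Multiset.mem_toFinset.mpr h)))
  rw [hk, hkM, Nat.choose_zero_right]

/-- If some box is over-demanded (`k(j) < k_M(j)`), `binomK = 0`. [folklore] -/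
theorem binomK_eq_zero_of_lt {B : Finset ℕ} {k kM : Multiset ℕ} {j : ℕ} (hj : j ∈ B)
    (hlt : k.count j < kM.count j) : binomK B k kM = 0 :=
  Finset.prod_eq_zero hj (Nat.choose_eq_zero_of_lt hlt)

/-- `binomK ≥ 1` when `k_M ≤ k`. [folklore] -/
theorem one_le_binomK {B : Finset ℕ} {k kM : Multiset ℕ} (hle : kM ≤ k) : 1 ≤ binomK B k kM :=
  Nat.one_le_iff_ne_zero.mpr (Finset.prod_ne_zero_iff.mpr fun j _ =>
    (Nat.choose_pos (Multiset.count_le_of_le j hle)).ne')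

/-- `b ::ₘ s = t ↔ b ∈ t ∧ s = t.erase b`. [folklore] -/
theorem cons_eq_iff_mem_and_eq_erase {b : ℕ} {s t : Multiset ℕ} : b ::ₘ s = t ↔ b ∈ t ∧ s = t.erase b := by
  constructor
  · rintro rfl; exact ⟨Multiset.mem_cons_self _ _, (Multiset.erase_cons_head b s).symm⟩
  · rintro ⟨hb, rfl⟩; exact Multiset.cons_erase hb

/-- Peeling one box in `binomK`: `binomK B (b ::ₘ k) kM = C(k(b) + 1, k_M(b)) · ∏_{j ∈ B ∖ {b}} C(k(j), k_M(j))`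
(`b ∈ B`). [folklore] -/
theorem binomK_cons {B : Finset ℕ} {b : ℕ} (hb : b ∈ B) (k kM : Multiset ℕ) :
    binomK B (b ::ₘ k) kM =
      (k.count b + 1).choose (kM.count b) * ∏ j ∈ B.erase b, (k.count j).choose (kM.count j) := by
  unfold binomK
  rw [← Finset.mul_prod_erase B _ hb, Multiset.count_cons_self]
  congr 1
  refine Finset.prod_congr rfl fun j hj => ?_
  rw [Multiset.count_cons_of_ne (Finset.ne_of_mem_erase hj)]

/-- The same peeling for `binomK B k kM` itself. [folklore] -/
theorem binomK_eq_mul_prod_erase {B : Finset ℕ} {b : ℕ} (hb : b ∈ B) (k kM : Multiset ℕ) :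
    binomK B k kM = (k.count b).choose (kM.count b) * ∏ j ∈ B.erase b, (k.count j).choose (kM.count j) := by
  unfold binomK
  rw [← Finset.mul_prod_erase B _ hb]

section Count

variable {D ε η : ℝ} (hD : 1 < D) (hε : 0 < ε) (hη : 0 < η)
include hD hε hη

/-- `pat (m p) = boxIdx p ::ₘ pat m` for a prime `p ∤ m`, `m ≠ 0`. [folklore] -/
theorem pat_mul_prime {m p : ℕ} (hp : p.Prime) (hm : m ≠ 0) (hpm : ¬ p ∣ m) :
    pat hD hε hη (m * p) = boxIdx hD hε hη p ::ₘ pat hD hε hη m := by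
  have hnot : p ∉ m.primeFactors := fun h => hpm (Nat.dvd_of_mem_primeFactors h)
  rw [pat, pat, BetaSieve.primeFactors_mul_prime hp hm, Finset.union_comm, ← Finset.insert_eq,
    Finset.insert_val_of_notMem hnot, Multiset.map_cons]

/-- **Counting the divisors of a squarefree number with a prescribed pattern**: for squarefree `t` and any
finite set `B` of boxes containing those of `t` and of `k_M`,
`#{m ∣ t : pat m = k_M} = ∏_{j ∈ B} C(#{p ∣ t : p in box j}, k_M(j))` (choose, box by box, which primes of `t`
go into `m`). [cite: IwaniecActaArith1980b, §2 p. 312 (bilinear form of the remainder)] -/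
theorem card_divisors_pat_eq {B : Finset ℕ} :
    ∀ {t : ℕ}, Squarefree t → ∀ {kM : Multiset ℕ}, (pat hD hε hη t).toFinset ∪ kM.toFinset ⊆ B →
      ((t.divisors.filter fun m => pat hD hε hη m = kM).card = binomK B (pat hD hε hη t) kM) := by
  intro t
  induction t using Nat.strong_induction_on with
  | _ t ih =>
    intro ht kM hB
    by_cases h1 : t = 1
    · subst h1
      rw [pat_one, Nat.divisors_one]
      by_cases hk : kM = 0
      · subst hk
        rw [Finset.filter_singleton, pat_one, if_pos rfl, Finset.card_singleton]
        unfold binomK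
        simp
      · have hcard : (({1} : Finset ℕ).filter fun m => pat hD hε hη m = kM).card = 0 := by
          rw [Finset.filter_singleton, pat_one, if_neg (Ne.symm hk), Finset.card_empty]
        rw [hcard]
        obtain ⟨j, hj⟩ := Multiset.exists_mem_of_ne_zero hk
        have hjB : j ∈ B := hB (Finset.mem_union_right _ (Multiset.mem_toFinset.mpr hj))
        exact (binomK_eq_zero_of_lt hjB (by rw [Multiset.count_zero]; exact Multiset.count_pos.mpr hj)).symm
    -- `t = t' p`, `p = q(t)`, `b` = the box of `p`
    have ht0 : t ≠ 0 := ht.ne_zero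
    have hp := Nat.minFac_prime h1
    set p := t.minFac with hpdef
    set t' := t / t.minFac with ht'def
    have ht'0 : t' ≠ 0 := (Nat.div_pos (Nat.minFac_le (Nat.pos_of_ne_zero ht0)) hp.pos).ne'
    have hpt' : ¬ p ∣ t' := BetaSieve.not_minFac_dvd_div ht h1
    have htt' : t' * p = t := BetaSieve.div_minFac_mul
    have hlt : t' < t := Nat.div_lt_self (Nat.pos_of_ne_zero ht0) hp.one_lt
    have ht'sq : Squarefree t' := ht.squarefree_of_dvd (Nat.div_dvd_of_dvd (Nat.minFac_dvd t))
    set b := boxIdx hD hε hη p with hbdef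
    have hpat : pat hD hε hη t = b ::ₘ pat hD hε hη t' := by
      rw [← htt', pat_mul_prime hD hε hη hp ht'0 hpt']
    have hbB : b ∈ B := hB (Finset.mem_union_left _ (Multiset.mem_toFinset.mpr (by rw [hpat]; exact Multiset.mem_cons_self _ _)))
    have hB' : (pat hD hε hη t').toFinset ∪ kM.toFinset ⊆ B := by
      refine Finset.Subset.trans (Finset.union_subset_union ?_ le_rfl) hB
      intro j hj
      rw [Multiset.mem_toFinset] at hj ⊢
      rw [hpat]; exact Multiset.mem_cons_of_mem hj
    have hB'' : (pat hD hε hη t').toFinset ∪ (kM.erase b).toFinset ⊆ B := by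
      refine Finset.Subset.trans (Finset.union_subset_union le_rfl ?_) hB'
      intro j hj
      rw [Multiset.mem_toFinset] at hj ⊢
      exact Multiset.mem_of_mem_erase hj
    -- split the divisors of `t' p`
    have hsplit : ((t.divisors.filter fun m => pat hD hε hη m = kM).card : ℕ) =
        (t'.divisors.filter fun m => pat hD hε hη m = kM).card +
          (if b ∈ kM then (t'.divisors.filter fun m => pat hD hε hη m = kM.erase b).card else 0) := by
      have h := BetaSieve.sum_divisors_mul_prime hp hpt' (fun m => if pat hD hε hη m = kM then (1 : ℝ) else 0)
      rw [htt'] at h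
      have e1 : ∀ s : Finset ℕ, ∀ q : ℕ → Prop, ∀ [DecidablePred q],
          ((s.filter q).card : ℝ) = ∑ m ∈ s, if q m then (1 : ℝ) else 0 := by
        intro s q _; rw [Finset.card_filter]; push_cast; rfl
      have e2 : ∑ m ∈ t'.divisors, (if pat hD hε hη (m * p) = kM then (1 : ℝ) else 0) =
          if b ∈ kM then ((t'.divisors.filter fun m => pat hD hε hη m = kM.erase b).card : ℝ) else 0 := by
        have hterm : ∀ m ∈ t'.divisors, (if pat hD hε hη (m * p) = kM then (1 : ℝ) else 0) =
            if b ∈ kM then (if pat hD hε hη m = kM.erase b then 1 else 0) else 0 := by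
          intro m hm
          have hm0 : m ≠ 0 := Nat.ne_of_gt (Nat.pos_of_mem_divisors hm)
          have hpm : ¬ p ∣ m := fun h => hpt' (h.trans (Nat.dvd_of_mem_divisors hm))
          rw [pat_mul_prime hD hε hη hp hm0 hpm]
          by_cases hbk : b ∈ kM
          · rw [if_pos hbk]
            by_cases hq : pat hD hε hη m = kM.erase b
            · rw [if_pos hq, if_pos (cons_eq_iff_mem_and_eq_erase.mpr ⟨hbk, hq⟩)]
            · rw [if_neg hq, if_neg (fun h => hq (cons_eq_iff_mem_and_eq_erase.mp h).2)]
          · rw [if_neg hbk, if_neg (fun h => hbk (cons_eq_iff_mem_and_eq_erase.mp h).1)]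
        rw [Finset.sum_congr rfl hterm]
        by_cases hbk : b ∈ kM
        · simp only [if_pos hbk]; rw [e1]
        · simp only [if_neg hbk]; rw [Finset.sum_const_zero]
      have : ((t.divisors.filter fun m => pat hD hε hη m = kM).card : ℝ) =
          (t'.divisors.filter fun m => pat hD hε hη m = kM).card +
            (if b ∈ kM then ((t'.divisors.filter fun m => pat hD hε hη m = kM.erase b).card : ℝ) else 0) := by
        rw [e1, h, ← e1, e2]
      have : ((t.divisors.filter fun m => pat hD hε hη m = kM).card : ℝ) =
          ((t'.divisors.filter fun m => pat hD hε hη m = kM).card +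
            (if b ∈ kM then (t'.divisors.filter fun m => pat hD hε hη m = kM.erase b).card else 0) : ℕ) := by
        rw [this]; push_cast; split_ifs <;> simp
      exact_mod_cast this
    rw [hsplit, ih t' hlt ht'sq hB', hpat, binomK_cons hbB]
    -- Pascal's rule at the box `b`
    set c := (pat hD hε hη t').count b with hcdef
    set x := kM.count b with hxdef
    set Q := ∏ j ∈ B.erase b, ((pat hD hε hη t').count j).choose (kM.count j) with hQdef
    by_cases hbk : b ∈ kM
    · rw [if_pos hbk, ih t' hlt ht'sq hB'', binomK_eq_mul_prod_erase hbB, binomK_eq_mul_prod_erase hbB,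
        Multiset.count_erase_self]
      have hQ' : ∏ j ∈ B.erase b, ((pat hD hε hη t').count j).choose ((kM.erase b).count j) = Q := by
        refine Finset.prod_congr rfl fun j hj => ?_
        rw [Multiset.count_erase_of_ne (Finset.ne_of_mem_erase hj)]
      rw [hQ']
      obtain ⟨y, hy⟩ : ∃ y, x = y + 1 := Nat.exists_eq_add_one_of_ne_zero (Multiset.count_pos.mpr hbk).ne'
      rw [← hxdef, ← hcdef, hy, Nat.add_sub_cancel, Nat.choose_succ_succ]
      ring
    · rw [if_neg hbk, add_zero, binomK_eq_mul_prod_erase hbB]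
      have hx0 : x = 0 := Multiset.count_eq_zero.mpr hbk
      rw [← hxdef, ← hcdef, hx0, Nat.choose_zero_right, Nat.choose_zero_right]

/-- The pattern is additive over coprime factors. [folklore] -/
theorem pat_mul_of_coprime {a b : ℕ} (hab : Nat.Coprime a b) :
    pat hD hε hη (a * b) = pat hD hε hη a + pat hD hε hη b := by
  rw [pat, pat, pat, hab.primeFactors_mul, ← Finset.disjUnion_eq_union _ _ hab.disjoint_primeFactors,
    Finset.disjUnion_val, Multiset.map_add]

end Count

/-! ### The coefficients of the bilinear forms -/

section Coeff

variable {D ε η : ℝ} (hD : 1 < D) (hε : 0 < ε) (hη : 0 < η)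

/-- The `m`-coefficient attached to the pattern `k` split as `k_M + k_N`:
`a_k(m) = λ_k φ((m, P_s)) [pat(m/(m, P_s)) = k_M] / c(k, k_M)` (`P_s` = the product of the small primes,
`φ` the inner weight of the pattern, `λ_k` its sign). [cite: IwaniecActaArith1980b, (9) p. 309 and p. 312] -/
def aCoef (Ps : ℕ) (φ : ℕ → ℝ) (lamk : ℝ) (k kM : Multiset ℕ) (m : ℕ) : ℝ :=
  lamk * φ (Nat.gcd m Ps) * (if pat hD hε hη (m / Nat.gcd m Ps) = kM then 1 else 0) /
    (binomK k.toFinset k kM : ℝ)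

/-- The `n`-coefficient: `b_k(n) = [(n, P_s) = 1] [pat n = k_N]`. [cite: IwaniecActaArith1980b, (9) p. 309 and p. 312] -/
def bCoef (Ps : ℕ) (kN : Multiset ℕ) (n : ℕ) : ℝ :=
  if Nat.gcd n Ps = 1 ∧ pat hD hε hη n = kN then 1 else 0

variable {Ps : ℕ} {φ : ℕ → ℝ} {lamk : ℝ} {k kM kN : Multiset ℕ}

/-- `|a_k(m)| ≤ 1` when `|λ_k|, |φ| ≤ 1`. [cite: IwaniecActaArith1980b, Theorem 1 ("bounded by 1")] -/
theorem abs_aCoef_le_one (hlam : |lamk| ≤ 1) (hφ : ∀ e, |φ e| ≤ 1) (m : ℕ) :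
    |aCoef hD hε hη Ps φ lamk k kM m| ≤ 1 := by
  unfold aCoef
  rw [abs_div, abs_mul, abs_mul]
  have h1 : |lamk| * |φ (Nat.gcd m Ps)| ≤ 1 := mul_le_one₀ hlam (abs_nonneg _) (hφ _)
  have h2 : |(if pat hD hε hη (m / Nat.gcd m Ps) = kM then (1:ℝ) else 0)| ≤ 1 := by
    split_ifs <;> simp
  have h3 : |lamk| * |φ (Nat.gcd m Ps)| * |(if pat hD hε hη (m / Nat.gcd m Ps) = kM then (1:ℝ) else 0)| ≤ 1 :=
    mul_le_one₀ h1 (abs_nonneg _) h2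
  rcases Nat.eq_zero_or_pos (binomK k.toFinset k kM) with h0 | hpos
  · rw [h0]; simp
  · rw [Nat.abs_cast]
    exact div_le_one_of_le₀ (h3.trans (by exact_mod_cast hpos)) (Nat.cast_nonneg _)

/-- `|b_k(n)| ≤ 1`. [cite: IwaniecActaArith1980b, Theorem 1 ("bounded by 1")] -/
theorem abs_bCoef_le_one (n : ℕ) : |bCoef hD hε hη Ps kN n| ≤ 1 := by
  unfold bCoef; split_ifs <;> simp

/-- Support of `b_k`: `b_k(n) ≠ 0` for squarefree `n ≠ 1` forces `n < ∏_{j ∈ k_N} D_{j+1} = (∏_{k_N} D_j)^{1+η}`.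
[cite: IwaniecActaArith1980b, p. 312] -/
theorem lt_of_bCoef_ne_zero {n : ℕ} (hn : Squarefree n) (hn1 : n ≠ 1) (h : bCoef hD hε hη Ps kN n ≠ 0) :
    (n : ℝ) < bprod (D := D) (ε := ε) (η := η) kN := by
  unfold bCoef at h
  split_ifs at h with hc
  · rw [← hc.2]; exact lt_bprod_pat hD hε hη hn hn1
  · exact absurd rfl h

/-- Support of `a_k`: if `φ(e) ≠ 0` forces `e < L`, then `a_k(m) ≠ 0` for squarefree `m` forces
`m < L · ∏_{j ∈ k_M} D_{j+1}`. [cite: IwaniecActaArith1980b, p. 312] -/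
theorem lt_of_aCoef_ne_zero {L : ℝ} (hφ : ∀ e, φ e ≠ 0 → (e : ℝ) < L) {m : ℕ} (hm : Squarefree m)
    (h : aCoef hD hε hη Ps φ lamk k kM m ≠ 0) :
    (m : ℝ) < L * bprod (D := D) (ε := ε) (η := η) kM := by
  unfold aCoef at h
  have hφ0 : φ (Nat.gcd m Ps) ≠ 0 := by
    intro h0; rw [h0] at h; simp at h
  have hpat : pat hD hε hη (m / Nat.gcd m Ps) = kM := by
    by_contra h0; rw [if_neg h0] at h; simp at h
  set g := Nat.gcd m Ps with hg
  have hgm : g ∣ m := Nat.gcd_dvd_left _ _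
  have hm0 : m ≠ 0 := hm.ne_zero
  have hg0 : g ≠ 0 := fun h0 => hm0 (Nat.eq_zero_of_zero_dvd (h0 ▸ hgm))
  have hr : Squarefree (m / g) := hm.squarefree_of_dvd (Nat.div_dvd_of_dvd hgm)
  have h1 : ((m / g : ℕ) : ℝ) ≤ bprod (D := D) (ε := ε) (η := η) kM := by
    rw [← hpat]; exact le_bprod_pat hD hε hη hr
  have h2 : (g : ℝ) < L := hφ _ hφ0
  have hmeq : (m : ℝ) = (g : ℝ) * ((m / g : ℕ) : ℝ) := by
    rw [← Nat.cast_mul, Nat.mul_div_cancel' hgm]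
  have hb0 : 0 < bprod (D := D) (ε := ε) (η := η) kM := by
    have : (0:ℝ) < ((m / g : ℕ) : ℝ) := by
      exact_mod_cast Nat.div_pos (Nat.le_of_dvd (Nat.pos_of_ne_zero hm0) hgm) (Nat.pos_of_ne_zero hg0)
    linarith
  rw [hmeq]
  calc (g : ℝ) * ((m / g : ℕ) : ℝ) ≤ (g : ℝ) * bprod (D := D) (ε := ε) (η := η) kM :=
        mul_le_mul_of_nonneg_left h1 (Nat.cast_nonneg _)
    _ < L * bprod (D := D) (ε := ε) (η := η) kM := mul_lt_mul_of_pos_right h2 hb0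

/-- **The convolution of the coefficients recovers the composite weight** (the heart of "the remainder
term has a bilinear form"): for `d = e t` with `e ∣ P_s` (small primes) and `t ∣ P_r` (a squarefree product
of large primes, coprime to `P_s`), and `k = k_M + k_N`,
`∑_{m ∣ d} a_k(m) b_k(d/m) = λ_k φ(e) [pat t = k]`.  (Only `m = e t'` with `t' ∣ t` contribute; the number of
`t' ∣ t` of pattern `k_M` is `c(k, k_M)` when `pat t = k`, by `card_divisors_pat_eq`.)
[cite: IwaniecActaArith1980b, §2 p. 312] -/
theorem sum_aCoef_bCoef_eq {Pr : ℕ} (hcop : Nat.Coprime Ps Pr) (hPs : Ps ≠ 0) (hPr : Squarefree Pr)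
    {e t : ℕ} (he : e ∣ Ps) (ht : t ∣ Pr) (hk : kM + kN = k) :
    ∑ m ∈ (e * t).divisors, aCoef hD hε hη Ps φ lamk k kM m * bCoef hD hε hη Ps kN (e * t / m) =
      lamk * φ e * (if pat hD hε hη t = k then 1 else 0) := by
  have he0 : e ≠ 0 := fun h => hPs (Nat.eq_zero_of_zero_dvd (h ▸ he))
  have htsq : Squarefree t := hPr.squarefree_of_dvd ht
  have ht0 : t ≠ 0 := htsq.ne_zero
  have het : Nat.Coprime e t := Nat.Coprime.coprime_dvd_left he (Nat.Coprime.coprime_dvd_right ht hcop)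
  have htPs : Nat.Coprime t Ps := (Nat.Coprime.coprime_dvd_left ht hcop.symm)
  rw [sum_divisors_mul_of_coprime het]
  -- only `e' = e` contributes
  rw [Finset.sum_eq_single_of_mem e (Nat.mem_divisors_self e he0)]
  · -- the terms with `e' = e`
    have hterm : ∀ t' ∈ t.divisors,
        aCoef hD hε hη Ps φ lamk k kM (e * t') * bCoef hD hε hη Ps kN (e * t / (e * t')) =
          lamk * φ e / (binomK k.toFinset k kM : ℝ) *
            (if pat hD hε hη t' = kM ∧ pat hD hε hη (t / t') = kN then 1 else 0) := by
      intro t' ht'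
      have ht't : t' ∣ t := Nat.dvd_of_mem_divisors ht'
      have ht'0 : t' ≠ 0 := Nat.ne_of_gt (Nat.pos_of_mem_divisors ht')
      have ht'Ps : Nat.Coprime t' Ps := Nat.Coprime.coprime_dvd_left ht't htPs
      have hq0 : t / t' ≠ 0 := (Nat.div_pos (Nat.le_of_dvd (Nat.pos_of_ne_zero ht0) ht't) (Nat.pos_of_ne_zero ht'0)).ne'
      have hqPs : Nat.Coprime (t / t') Ps := Nat.Coprime.coprime_dvd_left (Nat.div_dvd_of_dvd ht't) htPs
      have hg : Nat.gcd (e * t') Ps = e := by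
        rw [Nat.Coprime.gcd_mul_right_cancel e ht'Ps]; exact Nat.gcd_eq_left he
      have hdiv : e * t / (e * t') = t / t' := Nat.mul_div_mul_left t t' (Nat.pos_of_ne_zero he0)
      have hg2 : Nat.gcd (t / t') Ps = 1 := hqPs
      unfold aCoef bCoef
      rw [hg, Nat.mul_div_cancel_left t' (Nat.pos_of_ne_zero he0), hdiv]
      by_cases h1 : pat hD hε hη t' = kM <;> by_cases h2 : pat hD hε hη (t / t') = kN <;>
        simp [h1, h2, hg2]
    rw [Finset.sum_congr rfl hterm, ← Finset.mul_sum]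
    -- the pattern splits: `pat t' + pat (t/t') = pat t`
    have hsplit : ∀ t' ∈ t.divisors, pat hD hε hη t' + pat hD hε hη (t / t') = pat hD hε hη t := by
      intro t' ht'
      have ht't : t' ∣ t := Nat.dvd_of_mem_divisors ht'
      have ht'0 : t' ≠ 0 := Nat.ne_of_gt (Nat.pos_of_mem_divisors ht')
      have hq0 : t / t' ≠ 0 := (Nat.div_pos (Nat.le_of_dvd (Nat.pos_of_ne_zero ht0) ht't) (Nat.pos_of_ne_zero ht'0)).ne'
      have hco : Nat.Coprime t' (t / t') := by
        have := Nat.coprime_of_squarefree_mul (by rw [Nat.mul_div_cancel' ht't]; exact htsq)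
        exact this
      rw [← pat_mul_of_coprime hD hε hη hco, Nat.mul_div_cancel' ht't]
    by_cases hpt : pat hD hε hη t = k
    · rw [if_pos hpt, mul_one]
      have hkM : kM ≤ pat hD hε hη t := by rw [hpt, ← hk]; exact Multiset.le_add_right _ _
      have hcount : ∑ t' ∈ t.divisors, (if pat hD hε hη t' = kM ∧ pat hD hε hη (t / t') = kN then (1:ℝ) else 0) =
          ((t.divisors.filter fun m => pat hD hε hη m = kM).card : ℝ) := by
        rw [Finset.card_filter]; push_cast
        refine Finset.sum_congr rfl fun t' ht' => ?_
        by_cases h1 : pat hD hε hη t' = kM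
        · have h2 : pat hD hε hη (t / t') = kN := by
            have h := hsplit t' ht'
            rw [h1, hpt, ← hk] at h
            exact (add_right_inj kM).mp h
          rw [if_pos ⟨h1, h2⟩, if_pos h1]
        · rw [if_neg (fun h => h1 h.1), if_neg h1]
      have hkM' : kM ≤ k := hpt ▸ hkM
      rw [hcount, card_divisors_pat_eq hD hε hη htsq (B := k.toFinset) ?_, hpt]
      · have hc : (binomK k.toFinset k kM : ℝ) ≠ 0 := by
          have := one_le_binomK (B := k.toFinset) hkM'
          exact_mod_cast Nat.one_le_iff_ne_zero.mp this
        field_simp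
      · rw [hpt]
        refine Finset.union_subset le_rfl fun j hj => ?_
        rw [Multiset.mem_toFinset] at hj ⊢
        exact Multiset.mem_of_le hkM' hj
    · rw [if_neg hpt, mul_zero]
      have hzero : ∑ t' ∈ t.divisors, (if pat hD hε hη t' = kM ∧ pat hD hε hη (t / t') = kN then (1:ℝ) else 0) = 0 := by
        refine Finset.sum_eq_zero fun t' ht' => ?_
        rw [if_neg]
        rintro ⟨h1, h2⟩
        have h := hsplit t' ht'
        rw [h1, h2, hk] at h
        exact hpt h.symm
      rw [hzero, mul_zero]
  · -- the terms with `e' ≠ e` vanish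
    intro e' he' hne
    refine Finset.sum_eq_zero fun t' ht' => ?_
    have he'e : e' ∣ e := Nat.dvd_of_mem_divisors he'
    have he'0 : e' ≠ 0 := Nat.ne_of_gt (Nat.pos_of_mem_divisors he')
    have ht't : t' ∣ t := Nat.dvd_of_mem_divisors ht'
    have ht'0 : t' ≠ 0 := Nat.ne_of_gt (Nat.pos_of_mem_divisors ht')
    have hdiv : e * t / (e' * t') = e / e' * (t / t') := Nat.mul_div_mul_comm he'e ht't
    have hqPs : Nat.Coprime (t / t') Ps := Nat.Coprime.coprime_dvd_left (Nat.div_dvd_of_dvd ht't) htPs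
    have hg : Nat.gcd (e / e' * (t / t')) Ps = e / e' := by
      rw [Nat.Coprime.gcd_mul_right_cancel (e / e') hqPs]
      exact Nat.gcd_eq_left ((Nat.div_dvd_of_dvd he'e).trans he)
    have hne1 : e / e' ≠ 1 := fun h1 => hne (Nat.eq_of_dvd_of_div_eq_one he'e h1)
    unfold bCoef
    rw [hdiv, if_neg (fun h => hne1 (hg ▸ h.1)), mul_zero]

end Coeff

/-! ### Re-indexing the bilinear ranges by divisors -/

/-- **From `∑_{m < A} ∑_{n < B, mn ∣ P}` to `∑_{d ∣ P} ∑_{m ∣ d}`**: if the summand vanishes unless `m < A` and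
`n < B`, then `∑_{1 ≤ m < A} ∑_{1 ≤ n < B} [mn ∣ P] F(m, n) = ∑_{d ∣ P} ∑_{m ∣ d} F(m, d/m)` (`P ≠ 0`).
[folklore] -/
theorem sum_Ico_Ico_eq_sum_divisors {P : ℕ} (hP : P ≠ 0) {A B : ℕ} (F : ℕ → ℕ → ℝ)
    (hsupp : ∀ m n, m * n ∣ P → F m n ≠ 0 → m < A ∧ n < B) :
    ∑ m ∈ Finset.Ico 1 A, ∑ n ∈ Finset.Ico 1 B, (if m * n ∣ P then F m n else 0) =
      ∑ d ∈ P.divisors, ∑ m ∈ d.divisors, F m (d / m) := by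
  classical
  -- both sides as sums over the nonzero terms of a product / sigma finset
  rw [← Finset.sum_product', Finset.sum_sigma']
  rw [← Finset.sum_filter_ne_zero (s := Finset.Ico 1 A ×ˢ Finset.Ico 1 B),
    ← Finset.sum_filter_ne_zero (s := (P.divisors).sigma fun d => d.divisors)]
  refine Finset.sum_nbij' (fun x => ⟨x.1 * x.2, x.1⟩) (fun y => (y.2, y.1 / y.2)) ?_ ?_ ?_ ?_ ?_
  · rintro ⟨m, n⟩ hx
    simp only [Finset.mem_filter, Finset.mem_product, Finset.mem_Ico] at hx
    obtain ⟨⟨⟨hm1, -⟩, ⟨hn1, -⟩⟩, hne⟩ := hx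
    have hdvd : m * n ∣ P := by by_contra h; rw [if_neg h] at hne; exact hne rfl
    simp only [Finset.mem_filter, Finset.mem_sigma, Nat.mem_divisors]
    refine ⟨⟨⟨hdvd, hP⟩, dvd_mul_right m n, by positivity⟩, ?_⟩
    rw [Nat.mul_div_cancel_left n (by omega)]
    rw [if_pos hdvd] at hne; exact hne
  · rintro ⟨d, m⟩ hy
    simp only [Finset.mem_filter, Finset.mem_sigma, Nat.mem_divisors] at hy
    obtain ⟨⟨⟨hdP, -⟩, hmd, hd0⟩, hne⟩ := hy
    have hm0 : m ≠ 0 := fun h => hd0 (Nat.eq_zero_of_zero_dvd (h ▸ hmd))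
    have hmul : m * (d / m) = d := Nat.mul_div_cancel' hmd
    have hq0 : d / m ≠ 0 := fun h => hd0 (by rw [← hmul, h, mul_zero])
    obtain ⟨hA, hB⟩ := hsupp m (d / m) (hmul.symm ▸ hdP) hne
    simp only [Finset.mem_filter, Finset.mem_product, Finset.mem_Ico]
    refine ⟨⟨⟨Nat.one_le_iff_ne_zero.mpr hm0, hA⟩, ⟨Nat.one_le_iff_ne_zero.mpr hq0, hB⟩⟩, ?_⟩
    rw [hmul, if_pos hdP]; exact hne
  · rintro ⟨m, n⟩ hx
    simp only [Finset.mem_filter, Finset.mem_product, Finset.mem_Ico] at hx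
    have hm : 0 < m := by omega
    simp only [Nat.mul_div_cancel_left n hm]
  · rintro ⟨d, m⟩ hy
    simp only [Finset.mem_filter, Finset.mem_sigma, Nat.mem_divisors] at hy
    obtain ⟨⟨-, hmd, -⟩, -⟩ := hy
    simp only [Nat.mul_div_cancel' hmd]
  · rintro ⟨m, n⟩ hx
    simp only [Finset.mem_filter, Finset.mem_product, Finset.mem_Ico] at hx
    obtain ⟨⟨⟨hm1, -⟩, -⟩, hne⟩ := hx
    have hdvd : m * n ∣ P := by by_contra h; rw [if_neg h] at hne; exact hne rfl
    dsimp only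
    rw [if_pos hdvd, Nat.mul_div_cancel_left n (by omega)]

/-! ### Assembling: the remainder as a sum of bilinear forms over the universe of patterns -/

section Assembly

variable {D ε η : ℝ} (hD : 1 < D) (hε : 0 < ε) (hη : 0 < η)

/-- The `l`-th pattern of the universe `U` (enumerated by `Finset.equivFin`); junk (`0`) beyond `#U`.
[folklore] -/
def patOf (U : Finset (Multiset ℕ)) (l : ℕ) : Multiset ℕ :=
  if h : l < U.card then (U.equivFin.symm ⟨l, h⟩ : Multiset ℕ) else 0

/-- The sign `λ_k` and the inner weight selected by it, packaged: `φ_k = innerSel par φ⁺ φ⁻ λ_k`. [folklore] -/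
def phiOf (par : ℕ) (φP φM : ℕ → ℝ) (Λk : Multiset ℕ → ℝ) (k : Multiset ℕ) : ℕ → ℝ :=
  BetaSieve.innerSel par φP φM (Λk k)

/-- **The `m`-coefficients `a_{m,l}` of the `l`-th bilinear form** (zero for `l ≥ #U`).
[cite: IwaniecActaArith1980b, (9) p. 309] -/
def coefA (Ps : ℕ) (par : ℕ) (φP φM : ℕ → ℝ) (Λk : Multiset ℕ → ℝ) (Mb : ℝ) (U : Finset (Multiset ℕ))
    (l m : ℕ) : ℝ :=
  if l < U.card then
    aCoef hD hε hη Ps (phiOf par φP φM Λk (patOf U l)) (Λk (patOf U l)) (patOf U l)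
      (splitK (D := D) (ε := ε) (η := η) Mb (patOf U l)).1 m
  else 0

/-- **The `n`-coefficients `b_{n,l}` of the `l`-th bilinear form** (zero for `l ≥ #U`).
[cite: IwaniecActaArith1980b, (9) p. 309] -/
def coefB (Ps : ℕ) (Mb : ℝ) (U : Finset (Multiset ℕ)) (l n : ℕ) : ℝ :=
  if l < U.card then bCoef hD hε hη Ps (splitK (D := D) (ε := ε) (η := η) Mb (patOf U l)).2 n else 0

variable {Ps Pr : ℕ} {par : ℕ} {φP φM : ℕ → ℝ} {Λk : Multiset ℕ → ℝ} {Mb Nb : ℝ} {U : Finset (Multiset ℕ)}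

/-- `|a_{m,l}| ≤ 1` when `|λ_k|, |φ^±| ≤ 1`. [cite: IwaniecActaArith1980b, Theorem 1] -/
theorem abs_coefA_le_one (hΛ : ∀ k, |Λk k| ≤ 1) (hP : ∀ e, |φP e| ≤ 1) (hM : ∀ e, |φM e| ≤ 1)
    (l m : ℕ) : |coefA hD hε hη Ps par φP φM Λk Mb U l m| ≤ 1 := by
  unfold coefA
  split_ifs
  · exact abs_aCoef_le_one hD hε hη (hΛ _) (BetaSieve.abs_innerSel_le_one hP hM par _) m
  · simp

/-- `|b_{n,l}| ≤ 1`. [cite: IwaniecActaArith1980b, Theorem 1] -/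
theorem abs_coefB_le_one (l n : ℕ) : |coefB hD hε hη Ps Mb U l n| ≤ 1 := by
  unfold coefB
  split_ifs
  · exact abs_bCoef_le_one hD hε hη n
  · simp

/-- Summing a function of the `l`-th pattern over `l < L` (`L ≥ #U`) is summing over the universe. [folklore] -/
theorem sum_range_patOf {L : ℕ} (hL : U.card ≤ L) (G : Multiset ℕ → ℝ) :
    ∑ l ∈ Finset.range L, (if l < U.card then G (patOf U l) else 0) = ∑ k ∈ U, G k := by
  rw [← Finset.sum_range_add_sum_Ico _ hL]
  have h2 : ∑ l ∈ Finset.Ico U.card L, (if l < U.card then G (patOf U l) else 0) = 0 :=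
    Finset.sum_eq_zero fun l hl => if_neg (not_lt.mpr (Finset.mem_Ico.mp hl).1)
  rw [h2, add_zero, Finset.sum_range (fun l => if l < U.card then G (patOf U l) else 0)]
  have h3 : ∀ i : Fin U.card, (if (i : ℕ) < U.card then G (patOf U i) else 0) = G (U.equivFin.symm i : Multiset ℕ) := by
    intro i
    rw [if_pos i.isLt, patOf, dif_pos i.isLt]
  rw [Fintype.sum_congr _ _ h3]
  rw [← Finset.sum_coe_sort U G]
  exact Fintype.sum_equiv U.equivFin.symm _ _ fun _ => rfl

/-- **The remainder of the composite sieve is the sum of the bilinear forms.**  Let `P_s` (small primes) and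
`P_r` (large primes, squarefree) be coprime, `λ` weights on the divisors of `P_r` depending only on the
pattern (`λ(t) = Λ(pat t)`) whose support has patterns in the universe `U` and satisfying the hypothesis of
Lemma 1, `φ^±` inner weights supported below `L_φ`, `M', N' ≥ 1` with `M'N' = D`, and ranges
`A ≥ L_φ M'^{1+η}`, `B ≥ N'^{1+η}`, `B > 1`.  Then for EVERY function `r`,
`∑_{l < L} ∑_{1 ≤ m < A} ∑_{1 ≤ n < B} [mn ∣ P_s P_r] a_{m,l} b_{n,l} r(mn) = ∑_{d ∣ P_s P_r} Λ(d) r(d)`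
with `Λ = compSel par λ φ⁺ φ⁻` the sign-selected composite weight.
[cite: IwaniecActaArith1980b, (9) p. 309, Lemma 1 and p. 312, (23)–(24) p. 316] -/
theorem sum_bilinear_eq_sum_compSel (hcop : Nat.Coprime Ps Pr) (hPs : Squarefree Ps) (hPr : Squarefree Pr)
    {lam : ℕ → ℝ} (hlam : ∀ t, t ∣ Pr → lam t = Λk (pat hD hε hη t))
    (hU : ∀ t, t ∣ Pr → lam t ≠ 0 → pat hD hε hη t ∈ U)
    (hHyp : ∀ k ∈ U, Λk k ≠ 0 → HypL1 (D := D) (ε := ε) (η := η) k)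
    (hMb : 1 ≤ Mb) (hNb : 1 ≤ Nb) (hMN : Mb * Nb = D)
    {Lφ : ℝ} (hφP : ∀ e, φP e ≠ 0 → (e : ℝ) < Lφ) (hφM : ∀ e, φM e ≠ 0 → (e : ℝ) < Lφ)
    {A B : ℝ} (hA : Lφ * Mb ^ (1 + η) ≤ A) (hB : Nb ^ (1 + η) ≤ B) (hB1 : 1 < B)
    {L : ℕ} (hL : U.card ≤ L) (r : ℕ → ℝ) :
    ∑ l ∈ Finset.range L, ∑ m ∈ Finset.Ico 1 ⌈A⌉₊, ∑ n ∈ Finset.Ico 1 ⌈B⌉₊,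
        (if m * n ∣ Ps * Pr then coefA hD hε hη Ps par φP φM Λk Mb U l m * coefB hD hε hη Ps Mb U l n * r (m * n) else 0) =
      ∑ d ∈ (Ps * Pr).divisors, BetaSieve.compSel par lam φP φM Ps Pr d * r d := by
  have hPs0 : Ps ≠ 0 := hPs.ne_zero
  have hPr0 : Pr ≠ 0 := hPr.ne_zero
  have hP0 : Ps * Pr ≠ 0 := mul_ne_zero hPs0 hPr0
  have hPsq : Squarefree (Ps * Pr) := (Nat.squarefree_mul hcop).mpr ⟨hPs, hPr⟩
  have hD0 : (0 : ℝ) < D := by linarith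
  -- the bilinear form of one pattern
  set Bk : Multiset ℕ → ℝ := fun k =>
    ∑ m ∈ Finset.Ico 1 ⌈A⌉₊, ∑ n ∈ Finset.Ico 1 ⌈B⌉₊,
      (if m * n ∣ Ps * Pr then
        aCoef hD hε hη Ps (phiOf par φP φM Λk k) (Λk k) k (splitK (D := D) (ε := ε) (η := η) Mb k).1 m *
          bCoef hD hε hη Ps (splitK (D := D) (ε := ε) (η := η) Mb k).2 n * r (m * n) else 0) with hBk
  -- Step 1: the sum over `l` is the sum of `Bk` over the universe
  have h1 : ∑ l ∈ Finset.range L, ∑ m ∈ Finset.Ico 1 ⌈A⌉₊, ∑ n ∈ Finset.Ico 1 ⌈B⌉₊,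
        (if m * n ∣ Ps * Pr then coefA hD hε hη Ps par φP φM Λk Mb U l m * coefB hD hε hη Ps Mb U l n * r (m * n) else 0) =
      ∑ l ∈ Finset.range L, (if l < U.card then Bk (patOf U l) else 0) := by
    refine Finset.sum_congr rfl fun l _ => ?_
    by_cases hl : l < U.card
    · rw [if_pos hl, hBk]
      refine Finset.sum_congr rfl fun m _ => Finset.sum_congr rfl fun n _ => ?_
      simp only [coefA, coefB, if_pos hl]
    · rw [if_neg hl]
      refine Finset.sum_eq_zero fun m _ => Finset.sum_eq_zero fun n _ => ?_
      simp only [coefA, coefB, if_neg hl]; split_ifs <;> simp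
  rw [h1, sum_range_patOf hL]
  -- Step 2: each `Bk` as a sum over the divisors
  have hsupp_phi : ∀ k e, phiOf par φP φM Λk k e ≠ 0 → (e : ℝ) < Lφ := by
    intro k e h
    unfold phiOf BetaSieve.innerSel at h
    split_ifs at h
    · exact hφP e h
    · exact hφM e h
  have h2 : ∀ k ∈ U, Bk k = ∑ d ∈ (Ps * Pr).divisors, r d *
      (Λk k * phiOf par φP φM Λk k (Nat.gcd d Ps) * (if pat hD hε hη (Nat.gcd d Pr) = k then 1 else 0)) := by
    intro k hk
    by_cases hΛ0 : Λk k = 0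
    · -- everything vanishes
      have hzero : ∀ m, aCoef hD hε hη Ps (phiOf par φP φM Λk k) (Λk k) k (splitK (D := D) (ε := ε) (η := η) Mb k).1 m = 0 := by
        intro m; unfold aCoef; rw [hΛ0]; simp
      have hL0 : Bk k = 0 := by
        simp only [hBk]
        exact Finset.sum_eq_zero fun m _ => Finset.sum_eq_zero fun n _ => by rw [hzero m]; simp
      have hR0 : ∑ d ∈ (Ps * Pr).divisors, r d *
          (Λk k * phiOf par φP φM Λk k (Nat.gcd d Ps) * (if pat hD hε hη (Nat.gcd d Pr) = k then 1 else 0)) = 0 :=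
        Finset.sum_eq_zero fun d _ => by rw [hΛ0]; simp
      rw [hL0, hR0]
    obtain ⟨hsplit, hM', hN'⟩ := splitK_spec (D := D) (ε := ε) (η := η) hD0 hMb hNb hMN (hHyp k hk hΛ0)
    set kM := (splitK (D := D) (ε := ε) (η := η) Mb k).1
    set kN := (splitK (D := D) (ε := ε) (η := η) Mb k).2
    simp only [hBk]
    rw [sum_Ico_Ico_eq_sum_divisors hP0 (fun m n =>
      aCoef hD hε hη Ps (phiOf par φP φM Λk k) (Λk k) k kM m * bCoef hD hε hη Ps kN n * r (m * n))]
    · refine Finset.sum_congr rfl fun d hd => ?_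
      have hdP := Nat.dvd_of_mem_divisors hd
      have hdeq : d = Nat.gcd d Ps * Nat.gcd d Pr := BetaSieve.eq_gcd_mul_gcd_of_dvd hcop hdP
      have hterm : ∀ m ∈ d.divisors, aCoef hD hε hη Ps (phiOf par φP φM Λk k) (Λk k) k kM m *
          bCoef hD hε hη Ps kN (d / m) * r (m * (d / m)) =
          r d * (aCoef hD hε hη Ps (phiOf par φP φM Λk k) (Λk k) k kM m * bCoef hD hε hη Ps kN (d / m)) := by
        intro m hm
        rw [Nat.mul_div_cancel' (Nat.dvd_of_mem_divisors hm)]; ring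
      rw [Finset.sum_congr rfl hterm, ← Finset.mul_sum]
      congr 1
      conv_lhs => rw [hdeq]
      rw [sum_aCoef_bCoef_eq hD hε hη hcop hPs0 hPr (Nat.gcd_dvd_right d Ps) (Nat.gcd_dvd_right d Pr) hsplit]
    · -- support: `m < A`, `n < B`
      intro m n hmn hne
      have hmn_sq : Squarefree (m * n) := hPsq.squarefree_of_dvd hmn
      have hm : Squarefree m := hmn_sq.squarefree_of_dvd (dvd_mul_right m n)
      have hn : Squarefree n := hmn_sq.squarefree_of_dvd (dvd_mul_left n m)
      have ha : aCoef hD hε hη Ps (phiOf par φP φM Λk k) (Λk k) k kM m ≠ 0 := by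
        intro h; apply hne; rw [h]; ring
      have hb : bCoef hD hε hη Ps kN n ≠ 0 := by
        intro h; apply hne; rw [h]; ring
      constructor
      · refine Nat.lt_ceil.mpr ?_
        have h := lt_of_aCoef_ne_zero hD hε hη (hsupp_phi k) hm ha
        refine h.trans_le (le_trans ?_ hA)
        rw [bprod_eq_lprod_rpow hD0.le]
        have hLφ : 0 ≤ Lφ := by
          have := hsupp_phi k (Nat.gcd m Ps) (by intro h0; apply ha; unfold aCoef; rw [h0]; simp)
          exact le_trans (Nat.cast_nonneg _) this.le
        exact mul_le_mul_of_nonneg_left (Real.rpow_le_rpow (lprod_pos hD0 _).le hM' (by linarith)) hLφ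
      · refine Nat.lt_ceil.mpr ?_
        by_cases hn1 : n = 1
        · rw [hn1, Nat.cast_one]; exact hB1
        · have h := lt_of_bCoef_ne_zero hD hε hη hn hn1 hb
          refine h.trans_le (le_trans ?_ hB)
          rw [bprod_eq_lprod_rpow hD0.le]
          exact Real.rpow_le_rpow (lprod_pos hD0 _).le hN' (by linarith)
  rw [Finset.sum_congr rfl h2, Finset.sum_comm]
  refine Finset.sum_congr rfl fun d hd => ?_
  rw [← Finset.mul_sum, mul_comm]
  congr 1
  -- Step 3: the sum over the universe picks out `k = pat t`
  have hdP := Nat.dvd_of_mem_divisors hd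
  set t := Nat.gcd d Pr with htdef
  set e := Nat.gcd d Ps with hedef
  have htPr : t ∣ Pr := Nat.gcd_dvd_right d Pr
  have hsum : ∑ k ∈ U, Λk k * phiOf par φP φM Λk k e * (if pat hD hε hη t = k then 1 else 0) =
      if pat hD hε hη t ∈ U then Λk (pat hD hε hη t) * phiOf par φP φM Λk (pat hD hε hη t) e else 0 := by
    simp_rw [mul_ite, mul_one, mul_zero]
    rw [Finset.sum_ite_eq]
  rw [hsum, BetaSieve.compSel_apply, ← htdef, ← hedef, hlam t htPr]
  by_cases hmem : pat hD hε hη t ∈ U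
  · rw [if_pos hmem]; rfl
  · rw [if_neg hmem]
    have h0 : lam t = 0 := by
      by_contra h; exact hmem (hU t htPr h)
    rw [hlam t htPr] at h0
    rw [h0, zero_mul]

end Assembly

end Iwaniec1980b

end Literature.NumberTheory.Sieve

end
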